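import Mathlib
import HarnessLib
import HarnessLib.Audit
import Summits.MatrixMultiplication.Statement
import Literature.Computability.AlgebraicComplexity.MatrixMultiplicationExponent
import Literature.Computability.AlgebraicComplexity.FlatteningBound
import Literature.Computability.AlgebraicComplexity.TensorRankFactsProofs
import HarnessLib.Audit.Status.Attr

/-!
Route: NOFWindowCapacity

DORMANT since 2026-08-26T05:03:45Z (reconciler: no traction for 8.4 d (last activity item-evidence-added at 2026-08-17T19:34:16Z); parked, not closed — `ledger route dormant route-MatrixMultiplication-NOFWindowCapacity --off` to reactiv) — unstaffed, not closed; items shared with open routes are served there. `ledger route dormant <id> --off` reactivates.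

# Route NOFWindowCapacity — NOF partition protocols multiply matrices in quadratic time iff
entangled alien-free windows of abelian group tables reach capacity 3/2

X = the ENTANGLEMENT HORN of card nof-window-capacity (Alman–Blasiok's promise problem Π_G = (P_NOF,
T_G), AlmanBlasiok2023 §3.10, run to the end): for every ε > 0 there are N ≥ 2, a finite abelian
group G, Cohn–Umans leg maps s, t, u : [N] → G (X-entry (i,j) ↦ t_j − s_i, Y-entry (j,k) ↦ u_k −
t_j, output (i,k) ↦ u_k − s_i — the general form of an embedding of supp⟨N,N,N⟩ into the addition
table of an abelian group) and B combinatorial boxes P_r × Q_r × R_r (output / X / Y index sets ⊆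
[N]²) such that (i) every box is ALIEN-FREE: a triple (a,b,c) of the box lying on the group table
(leg b + leg c = leg a) is a matrix-multiplication triple (a.1 = b.1, b.2 = c.1, a.2 = c.2); (ii)
the N³ MM triples (i,j,k) are PARTITIONED by the boxes; (iii) B·|G| ≤ N^{2+ε}. Each box tensor is a
zeroing-out of the pulled-back addition table (rank ≤ |G|) and the box tensors sum to ⟨N,N,N⟩, so
R(⟨N,N,N⟩) ≤ B·|G| ≤ N^{2+ε} (linear accounting, AlmanBlasiok2023 Thm 32) and ω ≤ 2 + ε for every ε.
Lean: `∀ ε : ℝ, 0 < ε → ∃ N : ℕ, 2 ≤ N ∧ ∃ (G : Type) (_ : AddCommGroup G) (_ : Fintype G) (s t u :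
Fin N → G) (B : ℕ) (P Q R : Fin B → Finset (Fin N × Fin N)), (∀ r : Fin B, ∀ a ∈ P r, ∀ b ∈ Q r, ∀ c
∈ R r, (t b.2 - s b.1) + (u c.2 - t c.1) = u a.2 - s a.1 → a.1 = b.1 ∧ b.2 = c.1 ∧ a.2 = c.2) ∧ (∀ i
j k : Fin N, ∃! r : Fin B, (i, k) ∈ P r ∧ (i, j) ∈ Q r ∧ (j, k) ∈ R r) ∧ ((B * Fintype.card G : ℕ) :
ℝ) ≤ (N : ℝ) ^ (2 + ε)`

## Assembly
From PROVED tree facts only: given X at ε, PartitionRankBound yields R(⟨N,N,N⟩) ≤ B·|G| with N ≥ 2,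
so `advxxz2025_omega_le_logb_of_tensorRank_le` gives ω(ℂ) ≤ log_N(B|G|) ≤ log_N(N^{2+ε}) = 2 + ε
(Real.logb monotone, base N ≥ 2; the degenerate B|G| = 0 gives log = 0 ≤ 2 + ε anyway); ε → 0 gives
ω ≤ 2, and `two_le_omega` (Theorems/AsymptoticSpectrumOmegaGeTwo) gives ω = 2 =
`MatrixMultiplication` (Iff.rfl). AddTableRankLe feeds the proof of PartitionRankBound, not the
assembly term.

Rationale: WHY THIS LINE. AlmanBlasiok2023 (arXiv:2302.11476, §3.9 Thm 32, §3.10 Fact 37, Lemma 38 and the p.17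
remark) observe that a deterministic protocol for "is this cell of the table of G = (ℤ/Nℤ)² a
matrix-multiplication cell?" is a partition of the table into alien-free boxes, hence a BILINEAR
ALGORITHM with LINEAR accounting R(⟨N,N,N⟩) ≤ 2^{cc}·|G| (no τ-theorem, no character degrees), prove
(ω−2)log N ≤ cc ≤ log N, and note that the approach "could prove ω = 2 by using increasingly larger
n". The card isolates the one extremal invariant this hinges on — the WINDOW CAPACITY, the maximum
number of MM cells inside a single alien-free box — with the trichotomy |G| (one block = TPP,
CohnUmans2003 Lemma 3.1), |G|^{4/3} (disjoint blocks = STPP windows, CohnKleinbergSzegedyUmans2005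
§5, by Hölder) and |G|^{3/2} (any window, triangle counting), so that protocols can matter ONLY
through entangled (non-block) windows with |G|^{3/2−o(1)} cells: a clean dichotomy, both horns filed
(EntangledWindows vs WindowCapacityGap). Imported areas: multiparty communication complexity (NOF =
promise number-in-hand, cube partitions; Chandra–Furst–Lipton via AlmanBlasiok2023,
arXiv:1706.02207, arXiv:2102.00421), extremal graph theory (triangle counts,
supersaturation/stability for the negative horn) and additive combinatorics in ℤ_N² (corner-type
configurations; arXiv:2309.03878 for the block part). What it does that prior routes do not:
GroupTheoreticSTPP prices block windows by τ-accounting (and W2 shows linear accounting loses to τ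
on every block window), WindowedCompletionRank keeps ONE window and pays collisions with a
completion rank; here collisions are forbidden, windows are many and flat-priced, and a counted
invariant decides; the negatives index is empty.

RANKED CRUXES. #0 Thesis (target) — X as in § Thesis: for every ε > 0 an abelian host G, legs s,t,u
: [N] → G (N ≥ 2) and a partition of the N³ MM triples into B alien-free boxes with B·|G| ≤ N^{2+ε}.
(why it might fail: needs N^{o(1)} alien-free boxes of N^{3−o(1)} cells each in a host of order
N^{2+o(1)}; every window known has ≤ |G|^{1.07} cells (exactly |G| in ℤ_N² for N ≤ 4, card data);
WindowCapacityGap refutes it (GapKillsThesis).) [AlmanBlasiok2023, CohnUmans2003,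
CohnKleinbergSzegedyUmans2005, BlasiakChurchCohnGrochowNaslundSawinUmans2017]
#2 EntangledWindows (crux) — capacity horn (card C2 core, necessary for X by ThesisNeedsEntangled):
for every η > 0 there are N ≥ 2, a finite abelian G with |G| ≤ N^{2+η}, legs s,t,u and ONE
alien-free box holding at least N^{3−η} MM triples (window capacity exponent 3/2 − o(1) at host size
N^{2+o(1)}). [difficulty: open-problem] (why it might fail: block-union (STPP-type) windows are
capped at |G|^{4/3} (W2), so the window must be genuinely entangled; random j-dependent families and
every structured family tried give exactly N² = |G| in ℤ_N²; a stability theorem (WindowCapacityGap)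
kills it.) [AlmanBlasiok2023, CohnUmans2003, CohnKleinbergSzegedyUmans2005,
BlasiakChurchCohnGrochowNaslundSawinUmans2017, arXiv:2102.00421]
#3 WindowCapacityGap (crux) — NEGATIVE horn (card C1 in its weakest killing form; the new barrier
entry "NOF-partition protocols in abelian hosts"): there is η > 0 such that for every N, every
finite abelian G, all legs s,t,u and every alien-free box, the number of MM triples in the box is at
most |G|^{3/2−η} (uniform power saving over the triangle bound W3; the card conjectures the sharp
exponent 4/3, i.e. near-extremal windows are block unions). [difficulty: L] (why it might fail:
false iff entangled windows exist; slice rank is blind in ℤ_N and ℤ_N² (Behrend-type sets, BCCGU Thm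
B.8) and no supersaturation/stability theorem for triangle-rich alien-free configurations in group
tables is known; one η must also serve every small host.) [AlmanBlasiok2023,
BlasiakChurchCohnGrochowNaslundSawinUmans2017, BlasiakChurchCohnGrochowUmans2017, arXiv:2309.03878,
CohnUmans2003]
#4 CyclicSquareCapacity (crux) — Alman–Blasiok's host is saturated (card C4 in capacity form): in G
= ℤ_N × ℤ_N with their legs α(i,j) = (i−j, −j), β(j,k) = (j, j+k), γ(i,k) = (i,k), every alien-free
box holds at most N^{2+o(1)} MM triples (w = 1; exactly N² for N ≤ 4 by exhaustion). Consequence: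
every partition protocol for Π_{ℤ_N²} costs ≥ (1−o(1)) log N, i.e. the cc ≤ log N protocol of
AlmanBlasiok2023 Lemma 38 is optimal for this host and their "improve log n" question has a negative
answer for deterministic protocols. Normal form: with X_j = {i : (i,j) ∈ Q}, Y_j = {k : (j,k) ∈ R},
alien-free ⟺ P ∩ ((X_j × Y_{j'}) + (j'−j)(1,1)) = ∅ for j ≠ j', cells = Σ_j |P ∩ (X_j × Y_j)|.
[difficulty: M] (why it might fail: verified only for N ≤ 4 (exhaustive); composite N offers
subgroup rectangles and j-dependent translate families not yet excluded; a Behrend-type entangled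
family with N^{2+c} cells would refute it (and would be the first step of EntangledWindows).)
[AlmanBlasiok2023, arXiv:1706.02207, arXiv:2102.00421, arXiv:2309.03878,
ChristandlFawziTaZuiddam2022]
#5 BreachFourThirds (crux) — the first genuinely entangled window (card C3, sharpened): some
alien-free box in some abelian host holds MORE than |G|^{4/3} MM triples — by W2 (Hölder on the
packing of disjoint blocks) no union-of-blocks (STPP-type) window of any host of that order can
match it; a finite, machine-searchable milestone toward EntangledWindows. [difficulty: M] (why it
might fail: the 4/3-law (card C1: near-extremal alien-free windows are block unions, capped at
|G|^{4/3} by W2) may hold exactly at every size; W1+W3 exclude |G| ≤ 4, the ℤ_N² host gives only |G|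
for N ≤ 4, best known ratio is |G|^{1.06}.) [CohnKleinbergSzegedyUmans2005, CohnUmans2003,
AlmanBlasiok2023, BlasiakChurchCohnGrochowNaslundSawinUmans2017]
#9 AddTableRankLe (support) — the addition table [a + b = c] of a finite abelian group has tensor
rank ≤ |G| over ℂ (characters; Mathlib AddChar.sum_apply_eq_ite / AddChar.card_eq). Verbatim the
statement of WindowedCompletionRank.AddTableRankLe (stmt-MatrixMultiplication-5497) — shared item.
[difficulty: provable-now] [CohnUmans2003, AlmanBlasiok2023]
#9 PartitionRankBound (support) — Alman–Blasiok's partition lemma (Thm 32 with r = R): if B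
alien-free boxes partition the MM triples then R(⟨N,N,N⟩) ≤ B·|G| — each box tensor is the
pulled-back table (tensorRestrictsTo_precomp of the addition table, rank ≤ |G| by AddTableRankLe)
zeroed to the box, equal by alien-freeness to ⟨N,N,N⟩ restricted to the box's cells, and the B box
tensors sum to ⟨N,N,N⟩ (tensorRank_sum_le). [difficulty: provable-now] [AlmanBlasiok2023,
Blaser2013]
#9 SingleBlockBound (support) — W1 (one block, Cohn–Umans Lemma 3.1 form, no injectivity hypothesis
needed): if an alien-free box contains the full block A × M × C of MM triples then |A||M||C| ≤ |G| —
the map (i,j,k) ↦ −s_i + t_j + u_k is injective on the block (a collision produces a table triple in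
the box, which alien-freeness forces to be the same MM triple). [difficulty: provable-now]
[CohnUmans2003]
#9 TriangleBound (support) — W3 (any window): cells² ≤ |G|³. Alien-freeness forces each leg to be
injective on the ACTIVE indices (pairs occurring in some cell), so the cells are the triangles of a
tripartite graph with at most |G| edges between each two parts, and #triangles ≤ (e₁e₂e₃)^{1/2}
(Cauchy–Schwarz / Loomis–Whitney). [difficulty: provable-now] [CohnUmans2003, AlmanBlasiok2023]
#9 ThesisNeedsEntangled (support) — the thesis needs entangled windows: from X at ε the pigeonhole
gives a box with ≥ N³/B cells, TriangleBound gives |G| ≥ N^{2−2ε}, hence B ≤ N^{3ε} and that box has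
≥ N^{3−3ε} cells in a host of order ≤ N^{2+ε} (take ε = η/3). [difficulty: provable-now]
[AlmanBlasiok2023]
#9 GapKillsThesis (support) — the negative horn closes the route: from the gap exponent η take ε =
min(η/2, 1/2) in X; the largest box has ≥ N³/B cells ≤ |G|^{3/2−η} ≤ |G|·N^{(2+ε)(1/2−η)} (η < 1/2;
for η ≥ 1/2 it is ≤ |G|), so N³ ≤ N^{(2+ε)(3/2−η)} < N³ — contradiction for N ≥ 2 (pure
real-exponent bookkeeping, no rank facts). [difficulty: provable-now] [AlmanBlasiok2023]

TWO-LAYER PLAN. Foreseen glued splits (k ≤ 3, depth 1; nothing filed now): Thesis ⇐ EntangledWindows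
→ TilingFromCapacity → Thesis (a host whose table is PARTITIONED, not just met, by near-capacity
windows — the protocol formalism's extra demand); WindowCapacityGap ⇐ FourThirdsLaw (∀δ, cells ≤
|G|^{4/3+δ} eventually: stability of W1/W2) → SmallHosts (finite check) → WindowCapacityGap, or by
regime: bounded-exponent hosts (slice rank: a dense MM sub-support still carries an induced matching
of size |G|^{1−o(1)}, AlmanBlasiok2023 §3.6–3.7) → hosts with boundedly many cyclic factors
(arXiv:2309.03878-type Val obstructions) → glue; CyclicSquareCapacity ⇐ UniformFamilies
((X−X)∩(Y−Y)∩(T−T) = {0} ⇒ |X||Y||T| ≤ N², proved here by the injection (x,y,t) ↦ (x−y, y−t)) →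
EntangledFamilies (j-dependent X_j, Y_j) → CyclicSquareCapacity.

KILL CRITERIA. WindowCapacityGap proved ⇒ `close --reason refuted:Thesis` via GapKillsThesis and
file the barrier entry NOFPartitionBarrier (technique_class communication-protocol / alien-free
window partitions of abelian tables; blocks ω < 9/4 by this accounting, 7/3 at |G| = N^{2+o(1)});
EntangledWindows refuted (¬EntangledWindows proved) ⇒ same close via ThesisNeedsEntangled.
CyclicSquareCapacity proved ⇒ the Alman–Blasiok host is dead: pivot the positive horn to other hosts
(ℤ_N^k with k = k(N) → ∞ slowly, ℤ_p × ℤ_q, ℤ_{N²}) by a restate of EntangledWindows' informal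
scope, no new items. BreachFourThirds refuted (4/3-law exact at all sizes) ⇒ the method certifies at
best exponent 9/4: close `refuted:BreachFourThirds` with census. ω = 2 proved on another route moots
the positive horn; the negative horn (barrier entry) stays worth finishing.

NOT DECOMPOSED YET. W2 itself (block-union windows ≤ |G|^{4/3}: needs a block-union-window
predicate; provers attach it with `--supports WindowCapacityGap` if wanted); the normal form of
ℤ_N²-windows (stated in CyclicSquareCapacity's text, proved by whoever needs it); the tiling step
capacity ⇒ partition; the regime splits of WindowCapacityGap (bounded exponent / few cyclic factors
/ the rest); protocol-tree structure (protocol partitions are special box partitions — only needed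
for cc upper bounds, never for ω); non-abelian hosts (windows priced Σ d_i^ω — a different
accounting and a different route); randomized protocols (irrelevant to rank).

CHEAPEST FALSIFIER. One SAT/ILP run over the normal form of CyclicSquareCapacity at N = 5, 6, 7
(variables X_j, Y_j ⊆ ℤ_N per j and P ⊆ ℤ_N²; maximise Σ_j |P ∩ (X_j × Y_j)| subject to P avoiding
(X_j × Y_{j'}) + (j'−j)(1,1), j ≠ j'): the card's brute force gives exactly N² for N ≤ 4 (2^{2N²}
box pairs). A window with > N² cells at N ≤ 7 refutes the sharp form of rank 4 and is the first lead
toward BreachFourThirds / EntangledWindows; "= N² up to 7" backs ranks 3–4. Not run here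
(compute-free hub; it is the refuter's first kit job). Second cheapest: a two-line proof of
WindowCapacityGap from triangle removal + SingleBlockBound — if it exists the negative horn closes
at once (GapKillsThesis) and only the barrier entry survives.

NUMBERS. AlmanBlasiok2023 Lemma 38: (ω−2)·log N ≤ cc(P_NOF, T_{ℤ_N²}) ≤ log N. Capacity trichotomy
(card, re-derived here without leg-injectivity): one block ≤ |G| (W1), disjoint blocks ≤ |G|^{4/3}
(W2), any window ≤ min(|G|^{3/2}, N·|G|, N³) (W3 and the injection (i,j,k) ↦ (j, u_k − s_i)). Data
(card, exhaustive): WinCap(ℤ_N², AB legs) = N² = |G| for N = 2, 3, 4; normal-form model over ℤ_N: =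
N for N ≤ 5; best known ratio: two coordinate-line blocks in 𝔽_17³ tensored, cells = |G|^{1.060}.
Method ceiling under the 4/3-law: B|G| ≥ max(|G|, N³|G|^{−1/3}) ≥ N^{9/4} (exponent 9/4; 7/3 when
|G| = N^{2+o(1)}). To beat the record ω < 2.371339 (AlmanDuanVassilevskaWilliamsXuXuZhou2025) one
needs B|G| ≤ N^{2.3713}, i.e. average window ≥ N^{0.6287}·|G| cells at |G| = N^{2+o(1)}. Items at
open: 12 (1 target, 4 cruxes, 6 support, 1 assembly).

DEFINITION REQUESTS. None filed: alien-free boxes and cell counts are inlined Finset expressions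
over `Fin N × Fin N` (elaborated, Sketch.lean rc 0; the ℤ_N² encoding decide-checked at N = 2);
`tensorRank`, `matMulTensor`, `omega` exist in Literature.Computability.AlgebraicComplexity. Provers
may introduce local abbreviations (`AlienFree`, `windowCells`) in their Theorems files.

Novelty: Searches (2026-08-15): `lit citing arxiv:2302.11476` (4 citers: Riffle rank 2025; Kelley–Lovett–Meka
arXiv:2308.12451; arXiv:2306.00615; Pratt arXiv:2309.03878 — grep of its text: cites AB23 only for
the Ruzsa–Szemerédi/induced-matching footnote); `lit search --source zbmath "number on the forehead
matrix multiplication"` (5: AB23, Drucker–Kuhn–Oshman 2014 congested clique, Villagra et al. 2012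
arXiv:1202.6444, ChristandlFawziTaZuiddam2022, the CCC 2023 volume); `lit search --source zbmath
"triple product property abelian group matrix multiplication"` (1: Neumann 2011); `lit galaxy search
--star all` for "number-on-forehead communication matrix multiplication" and for the AB23 title (0 +
0), galaxy bm25 pdf on the NOF/promise/group-table question (15 rows: Magma notes, BIRS reports,
discreteness of asymptotic ranks — none on Π_G); AB23 held text re-read pp. 15–17 (Thm 32, Fact 37,
Lemma 38, p.17). Local searchd / OpenAlex / S2 / arXiv API unavailable this session (rc 75 / HTTP
429) — the card's refuter audit (2026-08-15) had already covered zbMATH NOF+MM 2022+ and the hub's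
56 cards.
Nearest prior art found: AlmanBlasiok2023 (arXiv:2302.11476) §3.9 Thm 32 (subadditive measures: cc ≥
log r(I)/r(P)), §3.10 Fact 37 + Lemma 38 ((ω−2)log n ≤ cc(P_NOF, T_{(ℤ/nℤ)²}) ≤ log n) and p.17 ("an
upper bound on ω obtained in this way would fall under the group-theoretic approach [CU03] using
(ℤ/nℤ)² … could prove ω = 2 by using increasingly larger n"); CohnUmans2003 Lemma 3.1 and CohnKleinb  [refs: 2302.11476, 2308.12451, 2306.00615, 2309.03878, 1202.6444, arxiv:2302.11476, ChristandlFawziTaZuiddam2022, AlmanBlasiok2023, CohnUmans2003, CohnKleinbergSzegedyUmans2005]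

Barriers (technique_class: communication-protocol, window-partition, group-theoretic): - technique_class: communication-protocol, window-partition, group-theoretic
- Literature.Barriers.MatrixMultiplication.TricoloredSumFreeBarrier: bites on block-union (STPP)
windows in hosts of BOUNDED exponent only; X needs hosts of order N^{2+o(1)} with windows of
N^{3−o(1)} cells, which by W2 cannot be block unions, and the canonical host ℤ_N² has exponent N → ∞
(the barrier's own evasion (a)); conceded: in bounded exponent a dense MM sub-support should still
carry an induced matching of size |G|^{1−o(1)} (AB23 §3.6–3.7), so bounded-exponent hosts are
expected dead — recorded as the first regime of WindowCapacityGap, not as an escape.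
- Literature.Barriers.MatrixMultiplication.InfimumNotMinimumBarrier: respected — each (N, partition)
certifies only ω ≤ log_N(B|G|) < exact 2 never; X quantifies ∀ε ∃N.
- Literature.Barriers.MatrixMultiplication.UniversalMethodBarrier: not met — no fixed intermediate
tensor is powered; T_G for abelian G is GL-equivalent to the unit tensor ⟨|G|⟩ (DFT), so "zero-outs
of T_{G_N} summing to ⟨N,N,N⟩" is a structured rank decomposition for a growing family, outside the
fixed-T class (CVZ §3.1 evasion: families t_k).
- Literature.Barriers.MatrixMultiplication.IrreversibilityBarrier: not met for the same reason (no
powers of a fixed tensor; unit tensors have i = 1).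
- Literature.Barriers.MatrixMultiplication.UnstableTensorBarrier: not met (no fixed
minimal-border-rank intermediate tensor).
- Literature.Barriers.MatrixMultiplication.NilpotentGroupBarr

Novelty grade: new-combination — ROUTE REVIEW (refuter) PASS; new-combination (concur w/ card audit, AB23 §3.9–3.10 re-read there; not a recombination of GroupTheoreticSTPP/WindowedCompletionRank; negatives 0). ELAB: tree file; all 12 decls probed rc0 (W_NOF.lean); cell-count Finset decide-evaluates. READ-BACK: boxes over pair-indi (refuter refuter-rreview-route-SmoothPoincare4-Tr-ef8906bd-0, 2026-08-15T13:57:28Z; prior: arXiv:2302.11476 (AB23 Thm32/Fact37/Lemma38/p17), CohnUmans2003 L3.1, CohnKleinbergSzegedyUmans2005 sec5, BCCGNSU2017, arXiv:2309.03878)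

History (route lifecycle, newest last):
- 2026-08-16T04:11:02Z · AUTO-CRUX (backfill): Thesis — hypotheses of the deciding theorem that nothing in the route derives are cruxes (operator:999:1085951)
- 2026-08-26T05:03:45Z · DORMANT — reconciler: no traction for 8.4 d (last activity item-evidence-added at 2026-08-17T19:34:16Z); parked, not closed — `ledger route dormant route-MatrixMultiplica (operator:999:1881674)

sub-problem: MatrixMultiplication · status: dormant · opened planner-plancard-MatrixMultiplication-MatrixM-e2a09709-0 2026-08-15T12:05:55Z · rev 2 · ledger route-MatrixMultiplication-NOFWindowCapacity
GENERATED by the gate from the ledger (D-0016/17). Provers cite these decls: `theorem foo : Summit.MatrixMultiplication.MatrixMultiplication.Theses.NOFWindowCapacity.<Decl> := …` in Summits/MatrixMultiplication/MatrixMultiplication/Theorems/<Name>.lean.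
-/

namespace Summit.MatrixMultiplication.MatrixMultiplication.Theses.NOFWindowCapacity

open scoped BigOperators Topology Manifold Classical MeasureTheory ProbabilityTheory Matrix InnerProductSpace ComplexConjugate ContinuousMap
open Filter Set Function TopologicalSpace MeasureTheory

attribute [summit_statement] _root_.MatrixMultiplication

/-- item stmt-MatrixMultiplication-7270 · crux (kind.auto-crux: conjecture-grade) · rank 0 · open · by planner
why it might fail: needs N^{o(1)} alien-free boxes of N^{3−o(1)} cells each in a host of order N^{2+o(1)}; every window known has ≤ |G|^{1.07} cells (exactly |G| in ℤ_N² for N ≤ 4, card data); WindowCapacityGap refutes it (GapKillsThesis).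
sources: AlmanBlasiok2023, CohnUmans2003, CohnKleinbergSzegedyUmans2005, BlasiakChurchCohnGrochowNaslundSawinUmans2017
[target] X as in § Thesis: for every ε > 0 an abelian host G, legs s,t,u : [N] → G (N ≥ 2) and a
partition of the N³ MM triples into B alien-free boxes with B·|G| ≤ N^{2+ε}. -/
@[route_item "route-MatrixMultiplication-NOFWindowCapacity", crux]
def Thesis : Prop :=
  ∀ ε : ℝ, 0 < ε → ∃ N : ℕ, 2 ≤ N ∧ ∃ (G : Type) (_ : AddCommGroup G) (_ : Fintype G) (s t u : Fin N → G) (B : ℕ) (P Q R : Fin B → Finset (Fin N × Fin N)), (∀ r : Fin B, ∀ a ∈ P r, ∀ b ∈ Q r, ∀ c ∈ R r, (t b.2 - s b.1) + (u c.2 - t c.1) = u a.2 - s a.1 → a.1 = b.1 ∧ b.2 = c.1 ∧ a.2 = c.2) ∧ (∀ i j k : Fin N, ∃! r : Fin B, (i, k) ∈ P r ∧ (i, j) ∈ Q r ∧ (j, k) ∈ R r) ∧ ((B * Fintype.card G : ℕ) : ℝ) ≤ (N : ℝ) ^ (2 + ε)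

/-- item stmt-MatrixMultiplication-7271 · crux · rank 2 · open · by planner
why it might fail: block-union (STPP-type) windows are capped at |G|^{4/3} (W2), so the window must be genuinely entangled; random j-dependent families and every structured family tried give exactly N² = |G| in ℤ_N²; a stability theorem (WindowCapacityGap) kills it.
sources: AlmanBlasiok2023, CohnUmans2003, CohnKleinbergSzegedyUmans2005, BlasiakChurchCohnGrochowNaslundSawinUmans2017, arXiv:2102.00421
[crux] capacity horn (card C2 core, necessary for X by ThesisNeedsEntangled): for every η > 0 there
are N ≥ 2, a finite abelian G with |G| ≤ N^{2+η}, legs s,t,u and ONE alien-free box holding at least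
N^{3−η} MM triples (window capacity exponent 3/2 − o(1) at host size N^{2+o(1)}). [difficulty:
open-problem] -/
@[route_item "route-MatrixMultiplication-NOFWindowCapacity"]
def EntangledWindows : Prop :=
  ∀ η : ℝ, 0 < η → ∃ N : ℕ, 2 ≤ N ∧ ∃ (G : Type) (_ : AddCommGroup G) (_ : Fintype G) (s t u : Fin N → G) (P Q R : Finset (Fin N × Fin N)), (∀ a ∈ P, ∀ b ∈ Q, ∀ c ∈ R, (t b.2 - s b.1) + (u c.2 - t c.1) = u a.2 - s a.1 → a.1 = b.1 ∧ b.2 = c.1 ∧ a.2 = c.2) ∧ (Fintype.card G : ℝ) ≤ (N : ℝ) ^ (2 + η) ∧ (N : ℝ) ^ (3 - η) ≤ ((Finset.univ.filter (fun x : Fin N × Fin N × Fin N => (x.1, x.2.2) ∈ P ∧ (x.1, x.2.1) ∈ Q ∧ (x.2.1, x.2.2) ∈ R)).card : ℝ)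

/-- item stmt-MatrixMultiplication-7272 · crux · rank 3 · open · by planner
why it might fail: false iff entangled windows exist; slice rank is blind in ℤ_N and ℤ_N² (Behrend-type sets, BCCGU Thm B.8) and no supersaturation/stability theorem for triangle-rich alien-free configurations in group tables is known; one η must also serve every small host.
sources: AlmanBlasiok2023, BlasiakChurchCohnGrochowNaslundSawinUmans2017, BlasiakChurchCohnGrochowUmans2017, arXiv:2309.03878, CohnUmans2003
[crux] NEGATIVE horn (card C1 in its weakest killing form; the new barrier entry "NOF-partition
protocols in abelian hosts"): there is η > 0 such that for every N, every finite abelian G, all legs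
s,t,u and every alien-free box, the number of MM triples in the box is at most |G|^{3/2−η} (uniform
power saving over the triangle bound W3; the card conjectures the sharp exponent 4/3, i.e.
near-extremal windows are block unions). [difficulty: L] -/
@[route_item "route-MatrixMultiplication-NOFWindowCapacity"]
def WindowCapacityGap : Prop :=
  ∃ η : ℝ, 0 < η ∧ ∀ (N : ℕ) (G : Type) [AddCommGroup G] [Fintype G] (s t u : Fin N → G) (P Q R : Finset (Fin N × Fin N)), (∀ a ∈ P, ∀ b ∈ Q, ∀ c ∈ R, (t b.2 - s b.1) + (u c.2 - t c.1) = u a.2 - s a.1 → a.1 = b.1 ∧ b.2 = c.1 ∧ a.2 = c.2) → ((Finset.univ.filter (fun x : Fin N × Fin N × Fin N => (x.1, x.2.2) ∈ P ∧ (x.1, x.2.1) ∈ Q ∧ (x.2.1, x.2.2) ∈ R)).card : ℝ) ≤ (Fintype.card G : ℝ) ^ ((3 : ℝ) / 2 - η)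

/-- item stmt-MatrixMultiplication-7273 · crux · rank 4 · open · by planner
why it might fail: verified only for N ≤ 4 (exhaustive); composite N offers subgroup rectangles and j-dependent translate families not yet excluded; a Behrend-type entangled family with N^{2+c} cells would refute it (and would be the first step of EntangledWindows).
sources: AlmanBlasiok2023, arXiv:1706.02207, arXiv:2102.00421, arXiv:2309.03878, ChristandlFawziTaZuiddam2022
[crux] Alman–Blasiok's host is saturated (card C4 in capacity form): in G = ℤ_N × ℤ_N with their
legs α(i,j) = (i−j, −j), β(j,k) = (j, j+k), γ(i,k) = (i,k), every alien-free box holds at most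
N^{2+o(1)} MM triples (w = 1; exactly N² for N ≤ 4 by exhaustion). Consequence: every partition
protocol for Π_{ℤ_N²} costs ≥ (1−o(1)) log N, i.e. the cc ≤ log N protocol of AlmanBlasiok2023 Lemma
38 is optimal for this host and their "improve log n" question has a negative answer for
deterministic protocols. Normal form: with X_j = {i : (i,j) ∈ Q}, Y_j = {k : (j,k) ∈ R}, alien-free
⟺ P ∩ ((X_j × Y_{j'}) + (j'−j)(1,1)) = ∅ for j ≠ j', cells = Σ_j |P ∩ (X_j × Y_j)|. [difficulty: M] -/
@[route_item "route-MatrixMultiplication-NOFWindowCapacity"]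
def CyclicSquareCapacity : Prop :=
  ∀ δ : ℝ, 0 < δ → ∃ N₀ : ℕ, ∀ N : ℕ, N₀ ≤ N → ∀ (P Q R : Finset (Fin N × Fin N)), (∀ a ∈ P, ∀ b ∈ Q, ∀ c ∈ R, ((b.1 : ℕ) : ZMod N) - ((b.2 : ℕ) : ZMod N) + ((c.1 : ℕ) : ZMod N) = ((a.1 : ℕ) : ZMod N) ∧ ((c.1 : ℕ) : ZMod N) + ((c.2 : ℕ) : ZMod N) - ((b.2 : ℕ) : ZMod N) = ((a.2 : ℕ) : ZMod N) → a.1 = b.1 ∧ b.2 = c.1 ∧ a.2 = c.2) → ((Finset.univ.filter (fun x : Fin N × Fin N × Fin N => (x.1, x.2.2) ∈ P ∧ (x.1, x.2.1) ∈ Q ∧ (x.2.1, x.2.2) ∈ R)).card : ℝ) ≤ (N : ℝ) ^ (2 + δ)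

/-- item stmt-MatrixMultiplication-7274 · crux · rank 5 · open · by planner
why it might fail: the 4/3-law (card C1: near-extremal alien-free windows are block unions, capped at |G|^{4/3} by W2) may hold exactly at every size; W1+W3 exclude |G| ≤ 4, the ℤ_N² host gives only |G| for N ≤ 4, best known ratio is |G|^{1.06}.
sources: CohnKleinbergSzegedyUmans2005, CohnUmans2003, AlmanBlasiok2023, BlasiakChurchCohnGrochowNaslundSawinUmans2017
[crux] the first genuinely entangled window (card C3, sharpened): some alien-free box in some
abelian host holds MORE than |G|^{4/3} MM triples — by W2 (Hölder on the packing of disjoint blocks)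
no union-of-blocks (STPP-type) window of any host of that order can match it; a finite,
machine-searchable milestone toward EntangledWindows. [difficulty: M] -/
@[route_item "route-MatrixMultiplication-NOFWindowCapacity"]
def BreachFourThirds : Prop :=
  ∃ (N : ℕ) (G : Type) (_ : AddCommGroup G) (_ : Fintype G) (s t u : Fin N → G) (P Q R : Finset (Fin N × Fin N)), (∀ a ∈ P, ∀ b ∈ Q, ∀ c ∈ R, (t b.2 - s b.1) + (u c.2 - t c.1) = u a.2 - s a.1 → a.1 = b.1 ∧ b.2 = c.1 ∧ a.2 = c.2) ∧ (Fintype.card G : ℝ) ^ ((4 : ℝ) / 3) < ((Finset.univ.filter (fun x : Fin N × Fin N × Fin N => (x.1, x.2.2) ∈ P ∧ (x.1, x.2.1) ∈ Q ∧ (x.2.1, x.2.2) ∈ R)).card : ℝ)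

/-- item stmt-MatrixMultiplication-5497 · support · rank 9 · closed · proved by Summit.MatrixMultiplication.MatrixMultiplication.Theorems.designFlattening_addTableRankLe_proof @ 683a8e7cca29 (prover) · by planner
sources: CohnUmans2003, AlmanBlasiok2023
[support] the addition table U_G(c; a, b) = [a + b = c] of a finite abelian group has rank ≤ |G|
over ℂ: [a+b−c = 0] = |G|⁻¹ Σ_ψ ψ(a)ψ(b)ψ(−c) over the |G| characters (Mathlib
AddChar.sum_apply_eq_ite, AddChar.card_eq). [difficulty: provable-now] -/
@[route_item "route-MatrixMultiplication-NOFWindowCapacity"]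
def AddTableRankLe : Prop :=
  ∀ (G : Type) [AddCommGroup G] [Fintype G] [DecidableEq G], Literature.Computability.AlgebraicComplexity.tensorRank (fun c a b : G => if a + b = c then (1 : ℂ) else 0) ≤ Fintype.card G

-- `AddTableRankLe` holds: proved by `Summit.MatrixMultiplication.MatrixMultiplication.Theorems.designFlattening_addTableRankLe_proof` @ 683a8e7cca29 (its module imports this route file, so no `_holds` link can be stated here).

/-- item stmt-MatrixMultiplication-7275 · support · rank 9 · closed · proved by Summit.MatrixMultiplication.MatrixMultiplication.Theorems.partitionRankBound_proof @ 23f44942b771 (prover) · by planner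
sources: AlmanBlasiok2023, Blaser2013
[support] Alman–Blasiok's partition lemma (Thm 32 with r = R): if B alien-free boxes partition the
MM triples then R(⟨N,N,N⟩) ≤ B·|G| — each box tensor is the pulled-back table
(tensorRestrictsTo_precomp of the addition table, rank ≤ |G| by AddTableRankLe) zeroed to the box,
equal by alien-freeness to ⟨N,N,N⟩ restricted to the box's cells, and the B box tensors sum to
⟨N,N,N⟩ (tensorRank_sum_le). [difficulty: provable-now] -/
@[route_item "route-MatrixMultiplication-NOFWindowCapacity", crux]
def PartitionRankBound : Prop :=
  ∀ (N : ℕ) (G : Type) [AddCommGroup G] [Fintype G] (s t u : Fin N → G) (B : ℕ) (P Q R : Fin B → Finset (Fin N × Fin N)), (∀ r : Fin B, ∀ a ∈ P r, ∀ b ∈ Q r, ∀ c ∈ R r, (t b.2 - s b.1) + (u c.2 - t c.1) = u a.2 - s a.1 → a.1 = b.1 ∧ b.2 = c.1 ∧ a.2 = c.2) → (∀ i j k : Fin N, ∃! r : Fin B, (i, k) ∈ P r ∧ (i, j) ∈ Q r ∧ (j, k) ∈ R r) → Literature.Computability.AlgebraicComplexity.tensorRank (Literature.Computability.AlgebraicComplexity.matMulTensor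 ℂ N N N) ≤ B * Fintype.card G

-- `PartitionRankBound` holds: proved by `Summit.MatrixMultiplication.MatrixMultiplication.Theorems.partitionRankBound_proof` @ 23f44942b771 (its module imports this route file, so no `_holds` link can be stated here).

/-- item stmt-MatrixMultiplication-7276 · support · rank 9 · closed · proved by Summit.MatrixMultiplication.MatrixMultiplication.Theorems.singleBlockBound_proof @ 6d597943b774 (prover) · by planner
sources: CohnUmans2003
[support] W1 (one block, Cohn–Umans Lemma 3.1 form, no injectivity hypothesis needed): if an
alien-free box contains the full block A × M × C of MM triples then |A||M||C| ≤ |G| — the map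
(i,j,k) ↦ −s_i + t_j + u_k is injective on the block (a collision produces a table triple in the
box, which alien-freeness forces to be the same MM triple). [difficulty: provable-now] -/
@[route_item "route-MatrixMultiplication-NOFWindowCapacity"]
def SingleBlockBound : Prop :=
  ∀ (N : ℕ) (G : Type) [AddCommGroup G] [Fintype G] (s t u : Fin N → G) (P Q R : Finset (Fin N × Fin N)) (A M C : Finset (Fin N)), (∀ a ∈ P, ∀ b ∈ Q, ∀ c ∈ R, (t b.2 - s b.1) + (u c.2 - t c.1) = u a.2 - s a.1 → a.1 = b.1 ∧ b.2 = c.1 ∧ a.2 = c.2) → (∀ i ∈ A, ∀ j ∈ M, ∀ k ∈ C, (i, k) ∈ P ∧ (i, j) ∈ Q ∧ (j, k) ∈ R) → A.card * M.card * C.card ≤ Fintype.card G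

-- `SingleBlockBound` holds: proved by `Summit.MatrixMultiplication.MatrixMultiplication.Theorems.singleBlockBound_proof` @ 6d597943b774 (its module imports this route file, so no `_holds` link can be stated here).

/-- item stmt-MatrixMultiplication-7277 · support · rank 9 · closed · proved by Summit.MatrixMultiplication.MatrixMultiplication.Theorems.triangleBound_proof @ e15c58067629 (prover) · by planner
sources: CohnUmans2003, AlmanBlasiok2023
[support] W3 (any window): cells² ≤ |G|³. Alien-freeness forces each leg to be injective on the
ACTIVE indices (pairs occurring in some cell), so the cells are the triangles of a tripartite graph
with at most |G| edges between each two parts, and #triangles ≤ (e₁e₂e₃)^{1/2} (Cauchy–Schwarz /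
Loomis–Whitney). [difficulty: provable-now] -/
@[route_item "route-MatrixMultiplication-NOFWindowCapacity"]
def TriangleBound : Prop :=
  ∀ (N : ℕ) (G : Type) [AddCommGroup G] [Fintype G] (s t u : Fin N → G) (P Q R : Finset (Fin N × Fin N)), (∀ a ∈ P, ∀ b ∈ Q, ∀ c ∈ R, (t b.2 - s b.1) + (u c.2 - t c.1) = u a.2 - s a.1 → a.1 = b.1 ∧ b.2 = c.1 ∧ a.2 = c.2) → (Finset.univ.filter (fun x : Fin N × Fin N × Fin N => (x.1, x.2.2) ∈ P ∧ (x.1, x.2.1) ∈ Q ∧ (x.2.1, x.2.2) ∈ R)).card ^ 2 ≤ Fintype.card G ^ 3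

-- `TriangleBound` holds: proved by `Summit.MatrixMultiplication.MatrixMultiplication.Theorems.triangleBound_proof` @ e15c58067629 (its module imports this route file, so no `_holds` link can be stated here).

/-- item stmt-MatrixMultiplication-7278 · support · rank 9 · closed · proved by Summit.MatrixMultiplication.MatrixMultiplication.Theorems.thesisNeedsEntangled_proof @ 2dd0c69042b7 (prover) · by planner
sources: AlmanBlasiok2023
[support] the thesis needs entangled windows: from X at ε the pigeonhole gives a box with ≥ N³/B
cells, TriangleBound gives |G| ≥ N^{2−2ε}, hence B ≤ N^{3ε} and that box has ≥ N^{3−3ε} cells in a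
host of order ≤ N^{2+ε} (take ε = η/3). [difficulty: provable-now] -/
@[route_item "route-MatrixMultiplication-NOFWindowCapacity"]
def ThesisNeedsEntangled : Prop :=
  Thesis → EntangledWindows

-- `ThesisNeedsEntangled` holds: proved by `Summit.MatrixMultiplication.MatrixMultiplication.Theorems.thesisNeedsEntangled_proof` @ 2dd0c69042b7 (its module imports this route file, so no `_holds` link can be stated here).

/-- item stmt-MatrixMultiplication-7279 · support · rank 9 · closed · proved by Summit.MatrixMultiplication.MatrixMultiplication.Theorems.gapKillsThesis_proof @ 1462cc6c49a0 (prover) · by planner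
sources: AlmanBlasiok2023
[support] the negative horn closes the route: from the gap exponent η take ε = min(η/2, 1/2) in X;
the largest box has ≥ N³/B cells ≤ |G|^{3/2−η} ≤ |G|·N^{(2+ε)(1/2−η)} (η < 1/2; for η ≥ 1/2 it is ≤
|G|), so N³ ≤ N^{(2+ε)(3/2−η)} < N³ — contradiction for N ≥ 2 (pure real-exponent bookkeeping, no
rank facts). [difficulty: provable-now] -/
@[route_item "route-MatrixMultiplication-NOFWindowCapacity"]
def GapKillsThesis : Prop :=
  WindowCapacityGap → ¬ Thesis

-- `GapKillsThesis` holds: proved by `Summit.MatrixMultiplication.MatrixMultiplication.Theorems.gapKillsThesis_proof` @ 1462cc6c49a0 (its module imports this route file, so no `_holds` link can be stated here).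

/-- item stmt-MatrixMultiplication-7280 · assembly · rank 1 · closed · proved by Summit.MatrixMultiplication.MatrixMultiplication.Theorems.nofWindowCapacity_assembly_proof @ e138801d7933 (prover) · by planner
sources: AlmanBlasiok2023, Blaser2013, AlmanDuanVassilevskaWilliamsXuXuZhou2025
[assembly] PartitionRankBound → Thesis → ω(ℂ) = 2. -/
@[route_item "route-MatrixMultiplication-NOFWindowCapacity"]
def Assembly : Prop :=
  PartitionRankBound → Thesis → MatrixMultiplication

-- `Assembly` holds: proved by `Summit.MatrixMultiplication.MatrixMultiplication.Theorems.nofWindowCapacity_assembly_proof` @ e138801d7933 (its module imports this route file, so no `_holds` link can be stated here).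

/-! D-0027 §2.1 — DECIDING THEOREM (planner-authored via `route open/edit --closes-file`; by planner-rbadge-MatrixMultiplication-NOFWindowC-f98986fa-g2-0 2026-08-15T16:15:08Z):
its hypotheses are this route's items and its conclusion the sub-problem Statement (glue_lint), and it elaborates with this file. -/

@[closes "route-MatrixMultiplication-NOFWindowCapacity"] theorem closes (hP : PartitionRankBound) (hX : Thesis) : MatrixMultiplication := by
  rw [_root_.MatrixMultiplication_iff]
  refine le_antisymm ?_ (Literature.Computability.AlgebraicComplexity.omega_two_le ℂ)
  refine le_of_forall_pos_le_add fun ε hε => ?_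
  obtain ⟨N, hN, G, instG, instF, s, t, u, B, P, Q, R, hAF, hPart, hB⟩ := hX ε hε
  -- linear accounting: R(⟨N,N,N⟩) ≤ B·|G|
  have hR : Literature.Computability.AlgebraicComplexity.tensorRank
      (Literature.Computability.AlgebraicComplexity.matMulTensor ℂ N N N) ≤ B * Fintype.card G :=
    hP N G s t u B P Q R hAF hPart
  have hN1 : 1 < N := hN
  -- B·|G| ≥ 1, since R(⟨N,N,N⟩) ≥ N² ≥ 4 (flattening bound)
  have hq1 : 1 ≤ B * Fintype.card G := by
    rcases Nat.eq_zero_or_pos (B * Fintype.card G) with h0 | h0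
    · exfalso
      have hsq := Literature.Computability.AlgebraicComplexity.matMulTensor_sq_le_tensorRank ℂ N
      have h4 : N ^ 2 ≤ 0 := hsq.trans (h0 ▸ hR)
      have hpos : 0 < N ^ 2 := pow_pos (by omega) 2
      omega
    · exact h0
  -- Bläser Thm 5.9 interpolation: log_N (B·|G|) is an admissible exponent, hence ≥ ω
  have hmem :=
    Literature.Computability.AlgebraicComplexity.Blaser2013_logb_mem_admissibleExponents ℂ hN1 hq1 hR
  have hω : Literature.Computability.AlgebraicComplexity.omega ℂ
      ≤ Real.logb (N : ℝ) ((B * Fintype.card G : ℕ) : ℝ) :=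
    csInf_le (Literature.Computability.AlgebraicComplexity.admissibleExponents_bddBelow ℂ) hmem
  refine hω.trans ?_
  -- log_N (B·|G|) ≤ 2 + ε from B·|G| ≤ N^(2+ε), N ≥ 2
  have hN1' : (1 : ℝ) < (N : ℝ) := by exact_mod_cast hN1
  have hq0 : (0 : ℝ) < ((B * Fintype.card G : ℕ) : ℝ) := by exact_mod_cast hq1
  rw [Real.logb_le_iff_le_rpow hN1' hq0]
  exact hB

end Summit.MatrixMultiplication.MatrixMultiplication.Theses.NOFWindowCapacity
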